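import Mathlib
import HarnessLib
import Summits.Ventures.LatticeQCDFlow.Scoring.AllPairsAcceptanceCeilingFree

/-!
# Per-block statistics of ONE proposal stream WITHOUT a weight ceiling: Chebyshev for the block
# mean weight (`Var w = M₂ − 1`) and for the block all-pairs acceptance estimate (row 3's
# envelope), block independence, and the scale-freeness of the printed block ratio

HONEST FRAMING: exact (Metropolis-corrected) sampling algorithms for lattice gauge theory;
figures of merit are autocorrelation/cost numbers at stated couplings and volumes; no
continuum-physics claim.

Venture `LatticeQCDFlow` (cell pub-lqcd), topic `Scoring`; FANOUT row 4 (`s0-u1-b`, rung S0-B).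
The block-level inputs of row 4's ceiling-free certificate for the PRINTED acceptance ratio
(`Scoring/AllPairsAcceptanceRatioCeilingFree`, next file): a code holds UNNORMALISED weights
`w̃ = c·w` (`w = p/q`, `c = Z` unknown) on its `n` proposals and prints per block `r` (draws
`rm, …, rm + m − 1`) the scale-free ratio `R_r = Û_r / W̄_r` of the all-pairs mean of
`min(w̃ᵢ, w̃ⱼ)` to the mean weight.  Everything here is SECOND-MOMENT level and needs NO ceiling
`p ≤ Wq`: the only analytic input beyond `∫ p = 1`, `q > 0` is `p²/q ∈ L¹(μ)` — a finite
`M₂ = ∫ p²/q dμ = 1/ESS` — stated as `Integrable`, never as a bare Bochner-integral bound (no junk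
value).  Row 3's `Scoring/AllPairsAcceptanceVariance` (the envelope `c₂ ≤ 1`, `c₁ ≤ acc`) and
`Scoring/ModelDensityPairLaw` (the `q dμ` dictionary), row 4's `Scoring/UStatisticMedianOfBlocks`
(blocks, `iIndepFun_block`) and `Scoring/AllPairsAcceptanceCeilingFree` (`blockVariance_pairMin_le`)
are imported, nothing restated.

## Content (`ν = μ.withDensity q`; `w = p/q`; `M₂ = ∫ p²/q dμ`; `acc = ∫∫ min(p(a)q(b), p(b)q(a)) dμ dμ`;
## `E_m(a) = (2(1 − a²) + 4(m − 2)(a − a²))/(m(m − 1))`)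

* `memLp_weight_model` (`w ∈ L²(ν)` from `p²/q ∈ L¹(μ)`), `integral_sq_weight_model`
  (`∫ w² dν = M₂`), **`variance_weight_model`** (`Var_ν w = M₂ − 1`);
* `blockRatio_scale_free` (the printed block ratio does not see `c`);
* `iIndepFun_blockFun` (any measurable function of the disjoint blocks of an independent stream
  gives independent random variables — grouping, Kallenberg Cor. 3.7);
* **`meanWeight_chebyshev_iid`** — `m ≥ 1` independent model draws, `u > 0`:
  `P(u ≤ |W̄ − 1|) ≤ (M₂ − 1)/(m u²)` (independent weights of mean `1`, variance `M₂ − 1`);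
* **`blockAllPairs_chebyshev`** — block `r` of `m ≥ 2` draws, `t > 0`:
  `P(t ≤ |Û_r − acc|) ≤ E_m(acc)/t²` (Hoeffding's exact block variance + row 3's envelope).

NEW WORK of the cell (elementary); no definition is introduced; nothing is cited as a fact.
NOT CLAIMED: anything exponential (next file, via the median of blocks); estimating `M₂`; any
number of ours re-scored.
-/

noncomputable section

namespace Summit.Ventures.LatticeQCDFlow.Scoring.AllPairsMedian

open MeasureTheory ProbabilityTheory Finset Real Set
open Summit.Ventures.LatticeQCDFlow.Scoring.BlockMedian

/-! ## §1 The weight under the model law with a finite second moment; block statistics -/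

section Weight

variable {X : Type*} [MeasurableSpace X] {μ : Measure X} [SFinite μ] {p q : X → ℝ}

omit [SFinite μ] in
/-- **`w = p/q ∈ L²(q dμ)` from `p²/q ∈ L¹(μ)`** (`(p/q)²·q = p²/q`); no ceiling. [ours] -/
theorem memLp_weight_model (hpm : Measurable p) (hq0 : ∀ z, 0 < q z) (hqm : Measurable q)
    (hM2i : Integrable (fun z => p z ^ 2 / q z) μ) :
    MemLp (fun a => p a / q a) 2 (μ.withDensity fun z => ENNReal.ofReal (q z)) := by
  have hwm : Measurable (fun a => p a / q a) := hpm.div hqm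
  rw [memLp_two_iff_integrable_sq hwm.aestronglyMeasurable,
    AllPairsVariance.integrable_withDensity_iff' (fun z => (hq0 z).le) hqm]
  have h : (fun a => (p a / q a) ^ 2 * q a) = fun a => p a ^ 2 / q a := by
    funext a
    field_simp [(hq0 a).ne']
  rw [h]
  exact hM2i

omit [SFinite μ] in
/-- `∫ w² d(q dμ) = ∫ p²/q dμ = M₂` (`= 1/ESS`). [ours] -/
theorem integral_sq_weight_model (hq0 : ∀ z, 0 < q z) (hqm : Measurable q) :
    ∫ a, (p a / q a) ^ 2 ∂(μ.withDensity fun z => ENNReal.ofReal (q z))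
      = ∫ z, p z ^ 2 / q z ∂μ := by
  rw [AllPairsVariance.integral_withDensity_eq' (fun z => (hq0 z).le) hqm]
  refine integral_congr_ae (Filter.Eventually.of_forall fun a => ?_)
  show (p a / q a) ^ 2 * q a = p a ^ 2 / q a
  field_simp [(hq0 a).ne']

omit [SFinite μ] in
/-- **`Var_{q dμ} w = M₂ − 1`** for a normalised target (`∫ p = 1`). [ours] -/
theorem variance_weight_model
    (hν : IsProbabilityMeasure (μ.withDensity fun z => ENNReal.ofReal (q z)))
    (hpm : Measurable p) (hpi : Integrable p μ) (hp1 : ∫ z, p z ∂μ = 1) (hq0 : ∀ z, 0 < q z)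
    (hqm : Measurable q) (hM2i : Integrable (fun z => p z ^ 2 / q z) μ) :
    Var[fun a => p a / q a; μ.withDensity fun z => ENNReal.ofReal (q z)]
      = (∫ z, p z ^ 2 / q z ∂μ) - 1 := by
  rw [variance_eq_sub (memLp_weight_model hpm hq0 hqm hM2i)]
  simp only [Pi.pow_apply]
  rw [integral_sq_weight_model hq0 hqm,
    (AllPairsVariance.integral_weight_withDensity_eq hpi hq0 hqm).2, hp1, one_pow]

omit [MeasurableSpace X] [SFinite μ] in
/-- **The printed block ratio is scale-free**: with `w̃ = c·(p/q)`, `c > 0`, the ratio of the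
all-pairs mean of `min(w̃ᵢ, w̃ⱼ)` to the mean of `w̃ⱼ` over a block equals the same ratio with the
normalised weights. [ours] -/
theorem blockRatio_scale_free {wt : X → ℝ} {c : ℝ} (hc : 0 < c)
    (hwt : ∀ z, wt z = c * (p z / q z)) {m : ℕ} (v : Fin m → X) :
    ((∑ z ∈ (univ : Finset (Fin m)).offDiag, min (wt (v z.1)) (wt (v z.2))) / (m * (m - 1) : ℝ))
        / ((∑ j : Fin m, wt (v j)) / m)
      = ((∑ z ∈ (univ : Finset (Fin m)).offDiag,
            min (p (v z.1) / q (v z.1)) (p (v z.2) / q (v z.2))) / (m * (m - 1) : ℝ))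
          / ((∑ j : Fin m, p (v j) / q (v j)) / m) := by
  have e1 : ∑ z ∈ (univ : Finset (Fin m)).offDiag, min (wt (v z.1)) (wt (v z.2))
      = c * ∑ z ∈ (univ : Finset (Fin m)).offDiag,
          min (p (v z.1) / q (v z.1)) (p (v z.2) / q (v z.2)) := by
    rw [Finset.mul_sum]
    refine Finset.sum_congr rfl fun z _ => ?_
    rw [hwt, hwt, mul_min_of_nonneg _ _ hc.le]
  have e2 : ∑ j : Fin m, wt (v j) = c * ∑ j : Fin m, p (v j) / q (v j) := by
    rw [Finset.mul_sum]
    exact Finset.sum_congr rfl fun j _ => hwt _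
  rw [e1, e2]
  set A : ℝ := ∑ z ∈ (univ : Finset (Fin m)).offDiag,
    min (p (v z.1) / q (v z.1)) (p (v z.2) / q (v z.2))
  set B : ℝ := ∑ j : Fin m, p (v j) / q (v j)
  rcases eq_or_ne B 0 with hB | hB
  · simp [hB]
  rcases eq_or_ne (m : ℝ) 0 with hm | hm
  · simp [hm]
  rcases eq_or_ne ((m : ℝ) - 1) 0 with hm1 | hm1
  · simp [hm1]
  field_simp

variable {Ω : Type*} [MeasurableSpace Ω] {P : Measure Ω} [IsProbabilityMeasure P]
variable {n m R : ℕ}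

omit [SFinite μ] [IsProbabilityMeasure P] in
/-- **Any measurable function of the disjoint blocks of an independent stream gives independent
random variables** (grouping, Kallenberg Cor. 3.7; the general form of
`BlockMedian.iIndepFun_blockUStat`). [ours] -/
theorem iIndepFun_blockFun {y : Fin n → Ω → X} (hym : ∀ j, Measurable (y j)) (hind : iIndepFun y P)
    (hRm : R * m ≤ n) {g : (Fin m → X) → ℝ} (hg : Measurable g) :
    iIndepFun (fun (r : Fin R) ω => g fun i => y ⟨(r : ℕ) * m + i, mul_add_lt hRm r i⟩ ω) P := by
  have h := Literature.Probability.Independence.iIndepFun_comp_of_pairwise_disjoint hym hind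
    (α := fun _ : Fin R => Fin m)
    (fun r i => (⟨(r : ℕ) * m + (i : ℕ), mul_add_lt hRm r i⟩ : Fin n)) ?_
    (T := fun _ => ℝ) (fun _ => g) fun _ => hg
  · exact h
  · intro r r' hrr' i i' h
    exact hrr' (Fin.ext (mul_add_inj i.isLt i'.isLt (congrArg Fin.val h)).1)

omit [SFinite μ] in
/-- **CHEBYSHEV FOR THE MEAN WEIGHT OF `m` INDEPENDENT MODEL DRAWS, ceiling-free**:
`P(u ≤ |W̄ − 1|) ≤ (M₂ − 1)/(m u²)`, `W̄ = Σ_{j<m} w(x_j)/m`, `M₂ = ∫ p²/q dμ` (the weights are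
independent with mean `1` and variance `M₂ − 1`). [ours] -/
theorem meanWeight_chebyshev_iid {x : Fin m → Ω → X} (hxm : ∀ j, Measurable (x j))
    (hind : iIndepFun x P) (hpm : Measurable p) (hpi : Integrable p μ) (hp1 : ∫ z, p z ∂μ = 1)
    (hq0 : ∀ z, 0 < q z) (hqm : Measurable q) (hM2i : Integrable (fun z => p z ^ 2 / q z) μ)
    (hlaw : ∀ j, Measure.map (x j) P = μ.withDensity fun z => ENNReal.ofReal (q z))
    (hm : 1 ≤ m) {u : ℝ} (hu : 0 < u) :
    P.real {ω | u ≤ |(∑ j : Fin m, p (x j ω) / q (x j ω)) / m - 1|}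
      ≤ ((∫ z, p z ^ 2 / q z ∂μ) - 1) / (m * u ^ 2) := by
  have hν : IsProbabilityMeasure (μ.withDensity fun z => ENNReal.ofReal (q z)) :=
    isProbabilityMeasure_of_map_eq_iid (hxm ⟨0, hm⟩) (hlaw ⟨0, hm⟩)
  have hwm : Measurable fun a => p a / q a := hpm.div hqm
  -- the weights `w ∘ x_j`: square-integrable, mean 1, variance `M₂ − 1`, independent
  have hw2 : ∀ j, MemLp (fun ω => p (x j ω) / q (x j ω)) 2 P := fun j => by
    have hw : MemLp (fun a => p a / q a) 2 (Measure.map (x j) P) := by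
      rw [hlaw]; exact memLp_weight_model hpm hq0 hqm hM2i
    exact hw.comp_of_map (hxm j).aemeasurable
  have hmean : ∀ j, ∫ ω, p (x j ω) / q (x j ω) ∂P = 1 := fun j => by
    have h := integral_map (μ := P) (hxm j).aemeasurable (f := fun a => p a / q a)
      hwm.aestronglyMeasurable
    rw [hlaw, (AllPairsVariance.integral_weight_withDensity_eq hpi hq0 hqm).2, hp1] at h
    exact h.symm
  have hvar : ∀ j, Var[fun ω => p (x j ω) / q (x j ω); P] = (∫ z, p z ^ 2 / q z ∂μ) - 1 :=
    fun j => by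
    have h := variance_map (μ := P) (X := fun a => p a / q a) (Y := x j)
      (by rw [hlaw]; exact hwm.aemeasurable) (hxm j).aemeasurable
    rw [hlaw, variance_weight_model hν hpm hpi hp1 hq0 hqm hM2i] at h
    exact h.symm
  have hind' : iIndepFun (fun j ω => p (x j ω) / q (x j ω)) P :=
    hind.comp (fun _ => fun a => p a / q a) fun _ => hwm
  -- the sum `S`: variance `m (M₂ − 1)`, mean `m`
  have hS2 : MemLp (fun ω => ∑ j : Fin m, p (x j ω) / q (x j ω)) 2 P :=
    memLp_finsetSum _ fun j _ => hw2 j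
  have hvarS : Var[fun ω => ∑ j : Fin m, p (x j ω) / q (x j ω); P]
      = m * ((∫ z, p z ^ 2 / q z ∂μ) - 1) := by
    have h := IndepFun.variance_sum (μ := P) (X := fun j ω => p (x j ω) / q (x j ω))
      (s := (univ : Finset (Fin m))) (fun j _ => hw2 j) fun i _ j _ hij => hind'.indepFun hij
    rw [Finset.sum_fn] at h
    rw [h, Finset.sum_congr rfl fun j _ => hvar j, sum_const, card_univ, Fintype.card_fin,
      nsmul_eq_mul]
  have hmeanS : ∫ ω, ∑ j : Fin m, p (x j ω) / q (x j ω) ∂P = (m : ℝ) := by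
    rw [integral_finsetSum _ fun j _ => (hw2 j).integrable one_le_two,
      Finset.sum_congr rfl fun j _ => hmean j, sum_const, card_univ, Fintype.card_fin,
      nsmul_eq_mul, mul_one]
  -- the mean `W̄ = S/m`: mean 1, `E(W̄ − 1)² = Var W̄ = (M₂ − 1)/m`
  have hm0 : (0 : ℝ) < m := by exact_mod_cast hm
  have hWeq : (fun ω => (∑ j : Fin m, p (x j ω) / q (x j ω)) / m)
      = fun ω => (m : ℝ)⁻¹ * ∑ j : Fin m, p (x j ω) / q (x j ω) := by
    funext ω; rw [div_eq_inv_mul]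
  have hW2 : MemLp (fun ω => (∑ j : Fin m, p (x j ω) / q (x j ω)) / m) 2 P := by
    rw [hWeq]; exact hS2.const_mul _
  have hmeanW : ∫ ω, (∑ j : Fin m, p (x j ω) / q (x j ω)) / m ∂P = 1 := by
    simp_rw [div_eq_inv_mul _ (m : ℝ)]
    rw [integral_const_mul, hmeanS, inv_mul_cancel₀ hm0.ne']
  have hvarW : Var[fun ω => (∑ j : Fin m, p (x j ω) / q (x j ω)) / m; P]
      = ((∫ z, p z ^ 2 / q z ∂μ) - 1) / m := by
    rw [hWeq, variance_const_mul, hvarS]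
    field_simp
  have hsq : ∫ ω, ((∑ j : Fin m, p (x j ω) / q (x j ω)) / m - 1) ^ 2 ∂P
      = ((∫ z, p z ^ 2 / q z ∂μ) - 1) / m := by
    rw [← hvarW, variance_eq_integral hW2.aestronglyMeasurable.aemeasurable]
    exact integral_congr_ae (Filter.Eventually.of_forall fun ω => by rw [hmeanW])
  calc P.real {ω | u ≤ |(∑ j : Fin m, p (x j ω) / q (x j ω)) / m - 1|}
      ≤ (∫ ω, ((∑ j : Fin m, p (x j ω) / q (x j ω)) / m - 1) ^ 2 ∂P) / u ^ 2 :=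
        measureReal_abs_sub_ge_le hW2 1 hu
    _ = ((∫ z, p z ^ 2 / q z ∂μ) - 1) / (m * u ^ 2) := by rw [hsq, div_div]

/-- **CHEBYSHEV FOR THE BLOCK ALL-PAIRS ESTIMATE, ceiling-free**: for block `r < R` of `m ≥ 2`
model draws and `t > 0`, `P(t ≤ |Û_r − acc|) ≤ E_m(acc)/t²` with row 3's envelope
`E_m(a) = (2(1 − a²) + 4(m − 2)(a − a²))/(m(m − 1))`. [ours] -/
theorem blockAllPairs_chebyshev {y : Fin n → Ω → X} (hym : ∀ j, Measurable (y j))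
    (hind : iIndepFun y P) (hp0 : ∀ z, 0 ≤ p z) (hpm : Measurable p) (hpi : Integrable p μ)
    (hp1 : ∫ z, p z ∂μ = 1) (hq0 : ∀ z, 0 < q z) (hqm : Measurable q) (hqi : Integrable q μ)
    (hlaw : ∀ j, Measure.map (y j) P = μ.withDensity fun z => ENNReal.ofReal (q z))
    (hm : 2 ≤ m) (hRm : R * m ≤ n) (r : Fin R) {t : ℝ} (ht : 0 < t) :
    P.real {ω | t ≤ |(∑ z ∈ (univ : Finset (Fin m)).offDiag,
            min (p (y ⟨(r : ℕ) * m + z.1, mul_add_lt hRm r z.1⟩ ω)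
                  / q (y ⟨(r : ℕ) * m + z.1, mul_add_lt hRm r z.1⟩ ω))
                (p (y ⟨(r : ℕ) * m + z.2, mul_add_lt hRm r z.2⟩ ω)
                  / q (y ⟨(r : ℕ) * m + z.2, mul_add_lt hRm r z.2⟩ ω)))
            / (m * (m - 1)) - ∫ a, ∫ b, min (p a * q b) (p b * q a) ∂μ ∂μ|}
      ≤ (2 * (1 - (∫ a, ∫ b, min (p a * q b) (p b * q a) ∂μ ∂μ) ^ 2)
          + 4 * (m - 2) * ((∫ a, ∫ b, min (p a * q b) (p b * q a) ∂μ ∂μ)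
            - (∫ a, ∫ b, min (p a * q b) (p b * q a) ∂μ ∂μ) ^ 2)) / (m * (m - 1)) / t ^ 2 := by
  have hn : 0 < n := by
    have := mul_add_lt hRm r ⟨0, by omega⟩
    omega
  have hν : IsProbabilityMeasure (μ.withDensity fun z => ENNReal.ofReal (q z)) :=
    isProbabilityMeasure_of_map_eq_iid (hym ⟨0, hn⟩) (hlaw ⟨0, hn⟩)
  have hF2 := AllPairsVariance.memLp_pairMin_two (μ := μ) hp0 hpm hpi hq0 hqm
  have hU2 := memLp_ustat₂_iid
    (x := fun (i : Fin m) => y ⟨(r : ℕ) * m + i, mul_add_lt hRm r i⟩) (fun i => hym _)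
    (iIndepFun_block hind hRm r) (fun i => hlaw _) (F := fun a b => min (p a / q a) (p b / q b))
    hF2
  have hvar := variance_ustat₂_eq_iid
    (x := fun (i : Fin m) => y ⟨(r : ℕ) * m + i, mul_add_lt hRm r i⟩) (fun i => hym _)
    (iIndepFun_block hind hRm r) (fun i => hlaw _) (F := fun a b => min (p a / q a) (p b / q b))
    (PairedDraws.measurable_pairMin hpm hqm) (fun a b => min_comm _ _) hF2 hm
  have key := hvar.trans_le (blockVariance_pairMin_le hν hp0 hpm hpi hp1 hq0 hqm hqi hm)
  rw [AllPairsVariance.integral_pairMin_withDensity_eq_meanAccept hp0 hpm hpi hq0 hqm hqi] at key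
  exact (measureReal_abs_sub_ge_le hU2 _ ht).trans (div_le_div_of_nonneg_right key (sq_nonneg t))

end Weight

end Summit.Ventures.LatticeQCDFlow.Scoring.AllPairsMedian

end
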